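import Literature.NumberTheory.DiophantineGeometry.IntegerGCDBoundProofs
import Literature.NumberTheory.DiophantineApproximation.PadicSubspaceTheoremRational
import HarnessLib

/-!
# Bugeaud–Corvaja–Zannier's `gcd(aⁿ − 1, bⁿ − 1) ≤ exp(εn)` modulo the catalogued `p`-adic Subspace Theorem

THEOREM ONLY (no definition, no named fact, no `sorry`): the domination of named facts
`Schlickewei1976_padicSubspaceTheorem → BugeaudCorvajaZannier2003_thm1` — the tree's proof
`BugeaudCorvajaZannier2003_thm1_of_subspaceTheorem` (`IntegerGCDBoundProofs.lean`, hypothesis `hST` = the rational-form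
`p`-adic Subspace Theorem over `ℚ`) fed with `Schlickewei1976_padicSubspaceTheorem.rational_int`
(`PadicSubspaceTheoremRational.lean`), which derives `hST` from the catalogued fact (Bilu, Sém. Bourbaki 967, Thm. 2.3).
Net debt 0; the fact DAG gains the edge Subspace ⇒ BCZ (Bombieri–Gubler 7.3.8: BCZ is an application of Cor. 7.2.5).

References: [BugeaudCorvajaZannier2003] Math. Z. 243 (2003) 79–84, Thm. 1; [Bilu2008] Sém. Bourbaki Exp. 967, Thm. 2.3;
[BombieriGubler2006] Cor. 7.2.5, 7.3.8.
-/

noncomputable section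

namespace Literature.NumberTheory.DiophantineGeometry

open Literature.NumberTheory.DiophantineApproximation

/-- **Bugeaud–Corvaja–Zannier 2003, Thm. 1, modulo the catalogued `p`-adic Subspace Theorem** (domination of named
facts): if `a, b ≥ 2` are multiplicatively independent then `gcd(aⁿ − 1, bⁿ − 1) ≤ exp(εn)` for `n ≥ n₀(ε)` — from
`Schlickewei1976_padicSubspaceTheorem` by the tree's `BugeaudCorvajaZannier2003_thm1_of_subspaceTheorem` and
`Schlickewei1976_padicSubspaceTheorem.rational_int`.
[cite: BugeaudCorvajaZannier2003, Thm. 1] [cite: Bilu2008, Thm. 2.3 (p. 967-04)] [cite: BombieriGubler2006, 7.3.8] -/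
theorem BugeaudCorvajaZannier2003_thm1_of_padicSubspaceTheorem (h : Schlickewei1976_padicSubspaceTheorem) :
    BugeaudCorvajaZannier2003_thm1 :=
  BugeaudCorvajaZannier2003_thm1_of_subspaceTheorem h.rational_int

end Literature.NumberTheory.DiophantineGeometry

end
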